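import Mathlib
import Summits.Ventures.PercRepro2.A3CutLoop
import Summits.Ventures.PercRepro2.A3PendantFree

/-!
# A mark-free part is invisible to the exploration of its cut vertex
(blind cell PercRepro2, night-1 g32; proofs/NIGHT1-G32.md §4 (E3))

Let `x` be a cut vertex with the marks in `VB ∪ {x}` and `G − P = loopA ends EA x` (A3CutLoop).  Every
generic fibre sum of `x` is the same on `G` and on `G − P` (`sum_fibre_x_eq_loopA`: both are the `B`-side
fibre sum, by `sum_fibre_x_restricted` at `Z = univ` and `sum_fibre_x_loopA`), hence

  **`btw_loopA`**: `btw(x)` on `G` = `btw(x)` on `G − P`;  **`FMfun_loopA`** likewise;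
  `A3Between_loopA_iff`.

With `btw_cut` (A3CutExpand) this reads: (MEANS-a₃) at `v` behind the cut reduces to (MEANS-a₃) ∧ (FM) at
`x` on the SMALLER instance `G − P`.  Exact check: check_cut_expand.py (E3), 190/190.  Standard axioms.
-/

namespace Summit.Ventures.PercRepro2

open UnionCluster CovForm CutV

namespace CovForm

namespace A3Fibre

/-! ## `btw` and `FMfun` at the cut vertex do not see the part -/

section Invisible

variable {V : Type*} {E : Type*} [Fintype V] [DecidableEq V] [Fintype E] [DecidableEq E]
  {R : Type*} [Field R] {ends : E → Sym2 V} {x : V}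
  {VA VB : Finset V} {EA EB : Set E} [DecidablePred (· ∈ EA)] [DecidablePred (· ∈ EB)] {p : E → R}
  {o a₁ a₂ b : V}

/-- The generic fibre sum of `x` is the same on `G` and on `G − P`. -/
lemma sum_fibre_x_eq_loopA (h : IsCut ends x ↑VA ↑VB EA EB) (ho : o ∈ insert x VB)
    (h1 : a₁ ∈ insert x VB) (h2 : a₂ ∈ insert x VB) (hb : b ∈ insert x VB)
    (T : Finset V → R → R → R → R → R → R) (hT0 : ∀ W, T W 0 0 0 0 0 = 0)
    (hThom : ∀ W c m sb so ub uo, T W (c * m) (c * sb) (c * so) (c * ub) (c * uo) =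
      c * T W m sb so ub uo)
    (hTB : ∀ S, S ⊆ VA → ∀ W, T (S ∪ W) = T W) :
    ∑ W, T W (mW p ends a₁ a₂ x W) (Ssig p ends a₁ a₂ x b W) (Ssig p ends a₁ a₂ x o W)
        (Su p ends a₁ a₂ x b W) (Su p ends a₁ a₂ x o W) =
      ∑ W, T W (mW p (loopA ends EA x) a₁ a₂ x W) (Ssig p (loopA ends EA x) a₁ a₂ x b W)
        (Ssig p (loopA ends EA x) a₁ a₂ x o W) (Su p (loopA ends EA x) a₁ a₂ x b W)
        (Su p (loopA ends EA x) a₁ a₂ x o W) := by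
  have huniv : (Set.univ : Set (Config E)) = sideEvent EA Set.univ := by
    ext ω; simp [mem_sideEvent]
  have h2' := sum_fibre_x_restricted (p := p) h ho h1 h2 hb Set.univ T hT0 hThom hTB
  rw [← huniv, prob_univ, one_mul] at h2'
  simp only [mZ_univ, SsigZ_univ, SuZ_univ] at h2'
  rw [h2', sum_fibre_x_loopA (p := p) h T hT0]

omit [Fintype V] [Fintype E] [DecidableEq E] [DecidablePred (· ∈ EB)] in
/-- `s3` does not see a set avoiding the roots (local copy). -/
lemma s3_union_left' {S : Finset V} (h1 : a₁ ∉ S) (h2 : a₂ ∉ S) (W : Finset V) :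
    (s3 a₁ a₂ (S ∪ W) : R) = s3 a₁ a₂ W := by
  unfold s3
  simp [Finset.mem_union, h1, h2]

omit [Fintype V] [Fintype E] [DecidableEq E] [Field R] [DecidablePred (· ∈ EA)]
  [DecidablePred (· ∈ EB)] in
/-- A vertex of `VB ∪ {x}` is not on the `A`-side (local copy). -/
lemma notMem_VA_of_mem_VB' (h : IsCut ends x ↑VA ↑VB EA EB) {u : V} (hu : u ∈ insert x VB) :
    u ∉ VA := by
  rcases Finset.mem_insert.1 hu with rfl | hu
  · exact fun hA => h.x_notA (Finset.mem_coe.2 hA)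
  · exact fun hA => Finset.disjoint_left.1 (Finset.disjoint_coe.1 h.disj) hA hu

omit [Fintype V] [Fintype E] [DecidableEq E] [Field R] [DecidablePred (· ∈ EA)]
  [DecidablePred (· ∈ EB)] in
/-- The `A`-condition does not see a set avoiding the roots (local copy). -/
lemma fibresA_cond_union_left' {S : Finset V} (h1 : a₁ ∉ S) (h2 : a₂ ∉ S) (W : Finset V) :
    (a₁ ∉ S ∪ W ∧ a₂ ∉ S ∪ W) ↔ (a₁ ∉ W ∧ a₂ ∉ W) := by
  simp [Finset.mem_union, h1, h2]

/-- **`btw` at the cut vertex does not see the part.** -/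
theorem btw_loopA (h : IsCut ends x ↑VA ↑VB EA EB) (ho : o ∈ insert x VB) (h1 : a₁ ∈ insert x VB)
    (h2 : a₂ ∈ insert x VB) (hb : b ∈ insert x VB) :
    btw p ends o a₁ a₂ x b = btw p (loopA ends EA x) o a₁ a₂ x b := by
  have hγ : gamma p ends o a₁ a₂ x = gamma p (loopA ends EA x) o a₁ a₂ x := by
    unfold gamma Do
    rw [probPDconn_loopA h h1 h2 h1 ho, probPDconn_loopA h h1 h2 h2 ho, probPD_loopA h h1 h2]
  have hA1 : ∀ S : Finset V, S ⊆ VA → a₁ ∉ S := fun S hS hc => notMem_VA_of_mem_VB' h h1 (hS hc)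
  have hA2 : ∀ S : Finset V, S ⊆ VA → a₂ ∉ S := fun S hS hc => notMem_VA_of_mem_VB' h h2 (hS hc)
  rw [← RootEdge.btwg_gamma, ← RootEdge.btwg_gamma, ← hγ]
  unfold RootEdge.btwg RootEdge.SFg
  rw [probQ_loopA h h1 h2, probPD_loopA h h1 h2, fibresA, Finset.sum_filter, Finset.sum_filter,
    Finset.sum_filter, Finset.sum_filter, Finset.sum_filter, Finset.sum_filter]
  rw [sum_fibre_x_eq_loopA h ho h1 h2 hb
      (fun W m sb so _ uo => sb * (so + s3 a₁ a₂ W * (gamma p ends o a₁ a₂ x * m - uo)) / m)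
      (fun W => by simp)
      (fun W (c m sb so ub uo : R) => by
        show c * sb * (c * so + s3 a₁ a₂ W * (gamma p ends o a₁ a₂ x * (c * m) - c * uo)) / (c * m) =
          c * (sb * (so + s3 a₁ a₂ W * (gamma p ends o a₁ a₂ x * m - uo)) / m)
        rw [show c * so + s3 a₁ a₂ W * (gamma p ends o a₁ a₂ x * (c * m) - c * uo) =
          c * (so + s3 a₁ a₂ W * (gamma p ends o a₁ a₂ x * m - uo)) by ring]
        exact mul_div_leaf_aux c sb _ m)
      (fun S hS W => by funext m sb so ub uo; rw [s3_union_left' (hA1 S hS) (hA2 S hS)]),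
    sum_fibre_x_eq_loopA h ho h1 h2 hb (fun _ _ sb _ _ _ => sb) (fun _ => rfl)
      (fun _ _ _ _ _ _ _ => rfl) (fun _ _ _ => rfl),
    sum_fibre_x_eq_loopA h ho h1 h2 hb
      (fun W m _ so _ uo => so + s3 a₁ a₂ W * (gamma p ends o a₁ a₂ x * m - uo))
      (fun W => by simp)
      (fun W (c m sb so ub uo : R) => by
        show c * so + s3 a₁ a₂ W * (gamma p ends o a₁ a₂ x * (c * m) - c * uo) =
          c * (so + s3 a₁ a₂ W * (gamma p ends o a₁ a₂ x * m - uo))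
        ring)
      (fun S hS W => by funext m sb so ub uo; rw [s3_union_left' (hA1 S hS) (hA2 S hS)]),
    sum_fibre_x_eq_loopA h ho h1 h2 hb
      (fun W m _ _ ub uo => if a₁ ∉ W ∧ a₂ ∉ W then ub * uo / m else 0)
      (fun W => by simp)
      (fun W (c m sb so ub uo : R) => by
        show (if a₁ ∉ W ∧ a₂ ∉ W then c * ub * (c * uo) / (c * m) else 0) =
          c * (if a₁ ∉ W ∧ a₂ ∉ W then ub * uo / m else 0)
        split_ifs
        · exact mul_div_leaf_aux c ub uo m
        · ring)
      (fun S hS W => by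
        funext m sb so ub uo
        simp only [fibresA_cond_union_left' (hA1 S hS) (hA2 S hS)]),
    sum_fibre_x_eq_loopA h ho h1 h2 hb (fun W _ _ _ ub _ => if a₁ ∉ W ∧ a₂ ∉ W then ub else 0)
      (fun W => by simp)
      (fun W (c m sb so ub uo : R) => by
        show (if a₁ ∉ W ∧ a₂ ∉ W then c * ub else 0) = c * (if a₁ ∉ W ∧ a₂ ∉ W then ub else 0)
        split_ifs <;> ring)
      (fun S hS W => by
        funext m sb so ub uo
        simp only [fibresA_cond_union_left' (hA1 S hS) (hA2 S hS)]),
    sum_fibre_x_eq_loopA h ho h1 h2 hb (fun W _ _ _ _ uo => if a₁ ∉ W ∧ a₂ ∉ W then uo else 0)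
      (fun W => by simp)
      (fun W (c m sb so ub uo : R) => by
        show (if a₁ ∉ W ∧ a₂ ∉ W then c * uo else 0) = c * (if a₁ ∉ W ∧ a₂ ∉ W then uo else 0)
        split_ifs <;> ring)
      (fun S hS W => by
        funext m sb so ub uo
        simp only [fibresA_cond_union_left' (hA1 S hS) (hA2 S hS)])]

/-- **`FMfun` at the cut vertex does not see the part.** -/
theorem FMfun_loopA (h : IsCut ends x ↑VA ↑VB EA EB) (ho : o ∈ insert x VB) (h1 : a₁ ∈ insert x VB)
    (h2 : a₂ ∈ insert x VB) (hb : b ∈ insert x VB) :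
    FMfun p ends o a₁ a₂ x b = FMfun p (loopA ends EA x) o a₁ a₂ x b := by
  have hγ : gamma0 p ends o a₁ a₂ = gamma0 p (loopA ends EA x) o a₁ a₂ := by
    unfold gamma0 LeafStep.mU
    rw [probQconn_loopA h h1 h2 h1 ho, probQconn_loopA h h1 h2 h2 ho, probQ_loopA h h1 h2]
  have hmU : ∀ y, y ∈ insert x VB →
      LeafStep.mU p ends a₁ a₂ y = LeafStep.mU p (loopA ends EA x) a₁ a₂ y := by
    intro y hy
    unfold LeafStep.mU
    rw [probQconn_loopA h h1 h2 h1 hy, probQconn_loopA h h1 h2 h2 hy]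
  have hA1 : ∀ S : Finset V, S ⊆ VA → a₁ ∉ S := fun S hS hc => notMem_VA_of_mem_VB' h h1 (hS hc)
  have hA2 : ∀ S : Finset V, S ⊆ VA → a₂ ∉ S := fun S hS hc => notMem_VA_of_mem_VB' h h2 (hS hc)
  unfold FMfun RootEdge.SFg
  rw [← hγ, hmU o ho, hmU b hb, probQ_loopA h h1 h2, probPD_loopA h h1 h2, fibresA,
    Finset.sum_filter, Finset.sum_filter, Finset.sum_filter, Finset.sum_filter, Finset.sum_filter,
    Finset.sum_filter]
  rw [sum_fibre_x_eq_loopA h ho h1 h2 hb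
      (fun W m sb so _ uo => sb * (so + s3 a₁ a₂ W * (gamma0 p ends o a₁ a₂ * m - uo)) / m)
      (fun W => by simp)
      (fun W (c m sb so ub uo : R) => by
        show c * sb * (c * so + s3 a₁ a₂ W * (gamma0 p ends o a₁ a₂ * (c * m) - c * uo)) / (c * m) =
          c * (sb * (so + s3 a₁ a₂ W * (gamma0 p ends o a₁ a₂ * m - uo)) / m)
        rw [show c * so + s3 a₁ a₂ W * (gamma0 p ends o a₁ a₂ * (c * m) - c * uo) =
          c * (so + s3 a₁ a₂ W * (gamma0 p ends o a₁ a₂ * m - uo)) by ring]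
        exact mul_div_leaf_aux c sb _ m)
      (fun S hS W => by funext m sb so ub uo; rw [s3_union_left' (hA1 S hS) (hA2 S hS)]),
    sum_fibre_x_eq_loopA h ho h1 h2 hb (fun _ _ sb _ _ _ => sb) (fun _ => rfl)
      (fun _ _ _ _ _ _ _ => rfl) (fun _ _ _ => rfl),
    sum_fibre_x_eq_loopA h ho h1 h2 hb
      (fun W m _ so _ uo => so + s3 a₁ a₂ W * (gamma0 p ends o a₁ a₂ * m - uo))
      (fun W => by simp)
      (fun W (c m sb so ub uo : R) => by
        show c * so + s3 a₁ a₂ W * (gamma0 p ends o a₁ a₂ * (c * m) - c * uo) =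
          c * (so + s3 a₁ a₂ W * (gamma0 p ends o a₁ a₂ * m - uo))
        ring)
      (fun S hS W => by funext m sb so ub uo; rw [s3_union_left' (hA1 S hS) (hA2 S hS)]),
    sum_fibre_x_eq_loopA h ho h1 h2 hb
      (fun W m _ _ ub uo => if a₁ ∉ W ∧ a₂ ∉ W then ub * uo / m else 0)
      (fun W => by simp)
      (fun W (c m sb so ub uo : R) => by
        show (if a₁ ∉ W ∧ a₂ ∉ W then c * ub * (c * uo) / (c * m) else 0) =
          c * (if a₁ ∉ W ∧ a₂ ∉ W then ub * uo / m else 0)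
        split_ifs
        · exact mul_div_leaf_aux c ub uo m
        · ring)
      (fun S hS W => by
        funext m sb so ub uo
        simp only [fibresA_cond_union_left' (hA1 S hS) (hA2 S hS)]),
    sum_fibre_x_eq_loopA h ho h1 h2 hb (fun W _ _ _ ub _ => if a₁ ∉ W ∧ a₂ ∉ W then ub else 0)
      (fun W => by simp)
      (fun W (c m sb so ub uo : R) => by
        show (if a₁ ∉ W ∧ a₂ ∉ W then c * ub else 0) = c * (if a₁ ∉ W ∧ a₂ ∉ W then ub else 0)
        split_ifs <;> ring)
      (fun S hS W => by
        funext m sb so ub uo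
        simp only [fibresA_cond_union_left' (hA1 S hS) (hA2 S hS)]),
    sum_fibre_x_eq_loopA h ho h1 h2 hb (fun W _ _ _ _ uo => if a₁ ∉ W ∧ a₂ ∉ W then uo else 0)
      (fun W => by simp)
      (fun W (c m sb so ub uo : R) => by
        show (if a₁ ∉ W ∧ a₂ ∉ W then c * uo else 0) = c * (if a₁ ∉ W ∧ a₂ ∉ W then uo else 0)
        split_ifs <;> ring)
      (fun S hS W => by
        funext m sb so ub uo
        simp only [fibresA_cond_union_left' (hA1 S hS) (hA2 S hS)])]

/-- **(MEANS-a₃) at the cut vertex does not see the part.** -/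
theorem A3Between_loopA_iff [LinearOrder R] (h : IsCut ends x ↑VA ↑VB EA EB) (ho : o ∈ insert x VB)
    (h1 : a₁ ∈ insert x VB) (h2 : a₂ ∈ insert x VB) (hb : b ∈ insert x VB) :
    A3Between p ends o a₁ a₂ x b ↔ A3Between p (loopA ends EA x) o a₁ a₂ x b := by
  unfold A3Between
  rw [btw_loopA h ho h1 h2 hb]

end Invisible

end A3Fibre

end CovForm

end Summit.Ventures.PercRepro2
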